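import Summits.CriticalPhenomena.PercolationContinuityZ3.Theorems.PercNearOneGluingNoHeavyLowerTailL1CertStruct
import Summits.CriticalPhenomena.PercolationContinuityZ3.Theorems.PercNearOneGluingNoHeavyLowerTailL1CertDictB
import Summits.CriticalPhenomena.PercolationContinuityZ3.Theorems.PercNearOneGluingNoHeavyLowerTailL1CertQuot
import Summits.CriticalPhenomena.PercolationContinuityZ3.Theorems.PercNearOneGluingNoHeavyLowerTailFourPointAtomsStep
import Summits.CriticalPhenomena.PercolationContinuityZ3.Theorems.PercNearOneGluingNoHeavyLowerTailFourPointFaceDefs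
import Summits.CriticalPhenomena.PercolationContinuityZ3.Theorems.PercNearOneGluingNoHeavyLowerTailGroupThreePointLB
import Summits.CriticalPhenomena.PercolationContinuityZ3.Theorems.PercNearOneGluingNoHeavyLowerTailHybridThreePointLB
import Literature.Probability.Percolation.StrongHarrisThreePoint
import HarnessLib

/-!
# `NoHeavyLowerTail` (stmt-CriticalPhenomena-4575) — kernel replay of the (L1) certificate: the rows ARE the tree theorems at the cells of a graph

Support file (prover seat `prim-bnk-1`, gen 3; `--supports stmt-CriticalPhenomena-4575`).  No named facts, no sorries; the structural identities
`row*_struct`, `target_struct` are `decide +kernel` computations on term lists (pure kernel); one small definition (`xc`, the cell point).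

For `μ = prodBernoulli w` on a finite vertex type and marked `a b c y`, let `x = xc w a b c y : ℕ → ℝ` be the four-point cell vector
(`x i = FourPointAtoms.cell w a b c y i`, `i < 15`).  This file proves that at `x` every signed row of the certificate data `…L1CertCols.rowsS` is VALID
(`evalT x minus ≤ evalT x plus`) on the region `x 1 ≤ x 2`, and that the target term lists evaluate to `CubicFourPoint.polL₁` of the cells:
* `row{i}_struct` — the explicit row polynomial equals its structured form (`agPlus/agMinus`, `e3Plus/e3Minus`);
* `row{i}_valid` — validity from the tree theorem: rows 0–3 Aas–Gladkov `prodBernoulli_threePoint_strongHarris` on `(abc),(aby),(acy),(bcy)`; 5, 6, 9 3PT-LB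
  `ThreePointLB.sahiE3_pairSep_nonneg`; 7, 8, 10, 13 GRP3PTLB `GroupThreePointLB.sahiE3_groupPairSep_nonneg`; 11, 12, 14 hybrid 3PT-LB
  `HybridThreePointLB.sahiE3_hybrid_nonneg`; 4 and 15 the same two theorems on the QUOTIENT `a = y` (`…L1CertQuot.real_update_ay` + merged cells);
* `rowsS_valid`, `target_eval` (`evalT x tP − evalT x tM = polL₁(cells)`), `certM_sq_le` (the multiplier dominates `W·x_i²` for the non-`b`-isolated cells).
-/

noncomputable section

namespace Summit.CriticalPhenomena.PercolationContinuityZ3.Theorems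

namespace L1Cert

open MeasureTheory Set CertCheck FourPointAtoms CubicFourPoint
open Literature.Probability.LatticeModels (prodBernoulli sahiE3 sahiE3_def)
open Literature.Probability.Percolation

/-! ## The cell point and its linear forms -/

section Point

variable {V : Type*} [Fintype V] (w : Sym2 V → unitInterval) (a b c y : V)

/-- The cell point of `(a,b,c,y)`: `x i = cell w a b c y i` for `i < 15`, `0` beyond. [this work] -/
def xc : ℕ → ℝ := fun i => if h : i < 15 then cell w a b c y ⟨i, h⟩ else 0

omit [Fintype V] in
/-- The cell point is nonnegative. [this work] -/
theorem xc_nonneg : ∀ i, 0 ≤ xc w a b c y i := by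
  intro i
  unfold xc
  split_ifs
  · exact cell_nonneg w a b c y _
  · exact le_rfl

omit [Fintype V] in
/-- Value of the cell point at `0`. [this work] -/ theorem xc_0 : xc w a b c y 0 = cell w a b c y 0 := rfl
omit [Fintype V] in
/-- Value of the cell point at `1`. [this work] -/ theorem xc_1 : xc w a b c y 1 = cell w a b c y 1 := rfl
omit [Fintype V] in
/-- Value of the cell point at `2`. [this work] -/ theorem xc_2 : xc w a b c y 2 = cell w a b c y 2 := rfl
omit [Fintype V] in
/-- Value of the cell point at `3`. [this work] -/ theorem xc_3 : xc w a b c y 3 = cell w a b c y 3 := rfl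
omit [Fintype V] in
/-- Value of the cell point at `4`. [this work] -/ theorem xc_4 : xc w a b c y 4 = cell w a b c y 4 := rfl
omit [Fintype V] in
/-- Value of the cell point at `5`. [this work] -/ theorem xc_5 : xc w a b c y 5 = cell w a b c y 5 := rfl
omit [Fintype V] in
/-- Value of the cell point at `6`. [this work] -/ theorem xc_6 : xc w a b c y 6 = cell w a b c y 6 := rfl
omit [Fintype V] in
/-- Value of the cell point at `7`. [this work] -/ theorem xc_7 : xc w a b c y 7 = cell w a b c y 7 := rfl
omit [Fintype V] in
/-- Value of the cell point at `8`. [this work] -/ theorem xc_8 : xc w a b c y 8 = cell w a b c y 8 := rfl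
omit [Fintype V] in
/-- Value of the cell point at `9`. [this work] -/ theorem xc_9 : xc w a b c y 9 = cell w a b c y 9 := rfl
omit [Fintype V] in
/-- Value of the cell point at `10`. [this work] -/ theorem xc_10 : xc w a b c y 10 = cell w a b c y 10 := rfl
omit [Fintype V] in
/-- Value of the cell point at `11`. [this work] -/ theorem xc_11 : xc w a b c y 11 = cell w a b c y 11 := rfl
omit [Fintype V] in
/-- Value of the cell point at `12`. [this work] -/ theorem xc_12 : xc w a b c y 12 = cell w a b c y 12 := rfl
omit [Fintype V] in
/-- Value of the cell point at `13`. [this work] -/ theorem xc_13 : xc w a b c y 13 = cell w a b c y 13 := rfl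
omit [Fintype V] in
/-- Value of the cell point at `14`. [this work] -/ theorem xc_14 : xc w a b c y 14 = cell w a b c y 14 := rfl
/-- The total mass of the cell point is one. [this work] -/
theorem linEval_σL : linEval (xc w a b c y) σL = 1 := by
  simp only [σL, linEval, List.map_cons, List.map_nil, List.sum_cons, List.sum_nil, add_zero, xc_0, xc_1, xc_2, xc_3, xc_4, xc_5, xc_6, xc_7, xc_8, xc_9, xc_10, xc_11, xc_12, xc_13, xc_14]
  have h := sum_cell_eq_one w a b c y
  linarith

omit [Fintype V] in
/-- `{ω | ∀ u' ∈ {u}, ω ∉ {c ↔ u'}} = {c ↮ u}`. [folklore] -/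
theorem setOf_forall_singleton (c u : V) :
    {ω : BondConfig V | ∀ u' ∈ ({u} : Finset V), ω ∉ openConn c u'} = (openConn c u)ᶜ := by
  ext ω; simp

omit [Fintype V] in
/-- `{ω | ∀ v' ∈ {u,v}, ∀ u' ∈ {p}, ω ∉ {v' ↔ u'}} = {u ↮ p} ∩ {v ↮ p}`. [folklore] -/
theorem setOf_forall₂_pair_singleton [DecidableEq V] (u v p : V) :
    {ω : BondConfig V | ∀ v' ∈ ({u, v} : Finset V), ∀ u' ∈ ({p} : Finset V), ω ∉ openConn v' u'} = (openConn u p)ᶜ ∩ (openConn v p)ᶜ := by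
  ext ω; simp

/-! ## Validity of the sixteen rows at the cell point -/

/-- Row 0 (`AG(abc)`) is valid at the cell point. [this work] -/
theorem row0_valid : evalT (xc w a b c y) (rowM 0) ≤ evalT (xc w a b c y) (rowP 0) := by
  have he := congrArg (evalT (xc w a b c y)) row0_struct
  simp only [evalT_normalize, evalT_append, evalT_agMinus, evalT_agPlus] at he
  simp only [linEval, List.map_cons, List.map_nil, List.sum_cons, List.sum_nil, add_zero, xc_0, xc_1, xc_2, xc_3, xc_4, xc_5, xc_6, xc_7, xc_8, xc_9, xc_10, xc_11, xc_12, xc_13, xc_14] at he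
  have h0 := prodBernoulli_threePoint_strongHarris w a b c
  rw [real_lu1, real_lu2, real_lu3, real_lt, real_shk_ABC] at h0
  linarith

/-- Row 1 (`AG(aby)`) is valid at the cell point. [this work] -/
theorem row1_valid : evalT (xc w a b c y) (rowM 1) ≤ evalT (xc w a b c y) (rowP 1) := by
  have he := congrArg (evalT (xc w a b c y)) row1_struct
  simp only [evalT_normalize, evalT_append, evalT_agMinus, evalT_agPlus] at he
  simp only [linEval, List.map_cons, List.map_nil, List.sum_cons, List.sum_nil, add_zero, xc_0, xc_1, xc_2, xc_3, xc_4, xc_5, xc_6, xc_7, xc_8, xc_9, xc_10, xc_11, xc_12, xc_13, xc_14] at he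
  have h0 := prodBernoulli_threePoint_strongHarris w a b y
  rw [real_xCabDay, real_xCayDab, real_xCbyDab, real_xCabCay, real_xDabDayDby] at h0
  linarith

/-- Row 2 (`AG(acy)`) is valid at the cell point. [this work] -/
theorem row2_valid : evalT (xc w a b c y) (rowM 2) ≤ evalT (xc w a b c y) (rowP 2) := by
  have he := congrArg (evalT (xc w a b c y)) row2_struct
  simp only [evalT_normalize, evalT_append, evalT_agMinus, evalT_agPlus] at he
  simp only [linEval, List.map_cons, List.map_nil, List.sum_cons, List.sum_nil, add_zero, xc_0, xc_1, xc_2, xc_3, xc_4, xc_5, xc_6, xc_7, xc_8, xc_9, xc_10, xc_11, xc_12, xc_13, xc_14] at he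
  have h0 := prodBernoulli_threePoint_strongHarris w a c y
  rw [real_xCacDay, real_xCayDac, real_xCcyDac, real_xCacCay, real_xDacDayDcy] at h0
  linarith

/-- Row 3 (`AG(bcy)`) is valid at the cell point. [this work] -/
theorem row3_valid : evalT (xc w a b c y) (rowM 3) ≤ evalT (xc w a b c y) (rowP 3) := by
  have he := congrArg (evalT (xc w a b c y)) row3_struct
  simp only [evalT_normalize, evalT_append, evalT_agMinus, evalT_agPlus] at he
  simp only [linEval, List.map_cons, List.map_nil, List.sum_cons, List.sum_nil, add_zero, xc_0, xc_1, xc_2, xc_3, xc_4, xc_5, xc_6, xc_7, xc_8, xc_9, xc_10, xc_11, xc_12, xc_13, xc_14] at he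
  have h0 := prodBernoulli_threePoint_strongHarris w b c y
  rw [real_xCbcDby, real_xCbyDbc, real_xCcyDbc, real_xCbcCby, real_xDbcDbyDcy] at h0
  linarith

/-- Row 4 (`AGq(abc)`) is valid at the cell point. [this work] -/
theorem row4_valid : evalT (xc w a b c y) (rowM 4) ≤ evalT (xc w a b c y) (rowP 4) := by
  classical
  have he := congrArg (evalT (xc w a b c y)) row4_struct
  simp only [evalT_normalize, evalT_append, evalT_agMinus, evalT_agPlus] at he
  simp only [linEval, List.map_cons, List.map_nil, List.sum_cons, List.sum_nil, add_zero, xc_0, xc_1, xc_2, xc_3, xc_4, xc_5, xc_6, xc_7, xc_8, xc_9, xc_10, xc_11, xc_12, xc_13, xc_14] at he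
  have h0 := prodBernoulli_threePoint_strongHarris (Function.update w s(a, y) 1) a b c
  simp only [real_update_ay] at h0
  rw [real_qCabDac, real_qCacDab, real_qCbcDab, real_qCabCac, real_qDabDacDbc] at h0
  linarith

/-- Row 5 (`HYB(P1=b;c=a;P3=c;P3'=c)`) is valid at the cell point. [this work] -/
theorem row5_valid : evalT (xc w a b c y) (rowM 5) ≤ evalT (xc w a b c y) (rowP 5) := by
  have he := congrArg (evalT (xc w a b c y)) row5_struct
  simp only [evalT_normalize, evalT_append, evalT_e3Minus, evalT_e3Plus, linEval_σL] at he
  simp only [linEval, List.map_cons, List.map_nil, List.sum_cons, List.sum_nil, add_zero, xc_0, xc_1, xc_2, xc_3, xc_4, xc_5, xc_6, xc_7, xc_8, xc_9, xc_10, xc_11, xc_12] at he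
  have h0 := ThreePointLB.sahiE3_pairSep_nonneg w a b c
  rw [sahiE3_def, real_shk_ABC, real_hyb2_C, real_hyb1_B, real_hyb1_A, real_shk_BC, real_shk_AC, real_shk_AB] at h0
  linarith

/-- Row 6 (`HYB(P1=b;c=a;P3=y;P3'=y)`) is valid at the cell point. [this work] -/
theorem row6_valid : evalT (xc w a b c y) (rowM 6) ≤ evalT (xc w a b c y) (rowP 6) := by
  have he := congrArg (evalT (xc w a b c y)) row6_struct
  simp only [evalT_normalize, evalT_append, evalT_e3Minus, evalT_e3Plus, linEval_σL] at he
  simp only [linEval, List.map_cons, List.map_nil, List.sum_cons, List.sum_nil, add_zero, xc_0, xc_1, xc_2, xc_3, xc_4, xc_5, xc_6, xc_7, xc_8, xc_9, xc_10, xc_11, xc_13] at he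
  have h0 := ThreePointLB.sahiE3_pairSep_nonneg w a b y
  rw [sahiE3_def, real_xDabDayDby, real_hyb2_C, real_xDay, real_xDby, real_xDayDby, real_xDabDby, real_xDabDay] at h0
  linarith

/-- Row 7 (`HYB(P1=b;c=a;P3=cy;P3'=cy)`) is valid at the cell point. [this work] -/
theorem row7_valid : evalT (xc w a b c y) (rowM 7) ≤ evalT (xc w a b c y) (rowP 7) := by
  classical
  have he := congrArg (evalT (xc w a b c y)) row7_struct
  simp only [evalT_normalize, evalT_append, evalT_e3Minus, evalT_e3Plus, linEval_σL] at he
  simp only [linEval, List.map_cons, List.map_nil, List.sum_cons, List.sum_nil, add_zero, xc_0, xc_1, xc_2, xc_3, xc_4, xc_5, xc_6, xc_7, xc_8, xc_9, xc_10, xc_11] at he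
  have h0 := GroupThreePointLB.sahiE3_groupPairSep_nonneg w ({c, y} : Finset V) ({b} : Finset V) a
  simp only [Finset.set_biInter_insert, Finset.set_biInter_singleton] at h0
  rw [sahiE3_def, real_xDcbDybIDcaDyaJDba, real_xDcbDyb, real_xDcaDya, real_xDba, real_xDcaDyaDba, real_xDcbDybDba, real_xDcbDybIDcaDyaJ] at h0
  linarith

/-- Row 8 (`HYB(P1=c;c=a;P3=by;P3'=by)`) is valid at the cell point. [this work] -/
theorem row8_valid : evalT (xc w a b c y) (rowM 8) ≤ evalT (xc w a b c y) (rowP 8) := by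
  classical
  have he := congrArg (evalT (xc w a b c y)) row8_struct
  simp only [evalT_normalize, evalT_append, evalT_e3Minus, evalT_e3Plus, linEval_σL] at he
  simp only [linEval, List.map_cons, List.map_nil, List.sum_cons, List.sum_nil, add_zero, xc_0, xc_1, xc_2, xc_3, xc_4, xc_5, xc_6, xc_7, xc_8, xc_9, xc_11, xc_12] at he
  have h0 := GroupThreePointLB.sahiE3_groupPairSep_nonneg w ({b, y} : Finset V) ({c} : Finset V) a
  simp only [Finset.set_biInter_insert, Finset.set_biInter_singleton] at h0
  rw [sahiE3_def, real_xDbcDycIDbaDyaJDca, real_xDbcDyc, real_xDbaDya, real_xDca, real_xDbaDyaDca, real_xDbcDycDca, real_xDbcDycIDbaDyaJ] at h0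
  linarith

/-- Row 9 (`HYB(P1=c;c=b;P3=y;P3'=y)`) is valid at the cell point. [this work] -/
theorem row9_valid : evalT (xc w a b c y) (rowM 9) ≤ evalT (xc w a b c y) (rowP 9) := by
  have he := congrArg (evalT (xc w a b c y)) row9_struct
  simp only [evalT_normalize, evalT_append, evalT_e3Minus, evalT_e3Plus, linEval_σL] at he
  simp only [linEval, List.map_cons, List.map_nil, List.sum_cons, List.sum_nil, add_zero, xc_0, xc_1, xc_2, xc_3, xc_4, xc_5, xc_6, xc_8, xc_9, xc_10, xc_11, xc_12, xc_13] at he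
  have h0 := ThreePointLB.sahiE3_pairSep_nonneg w b c y
  rw [sahiE3_def, real_xDbcDbyDcy, real_hyb1_A, real_xDby, real_xDcy, real_xDbyDcy, real_xDbcDcy, real_xDbcDby] at h0
  linarith

/-- Row 10 (`HYB(P1=c;c=b;P3=ay;P3'=ay)`) is valid at the cell point. [this work] -/
theorem row10_valid : evalT (xc w a b c y) (rowM 10) ≤ evalT (xc w a b c y) (rowP 10) := by
  classical
  have he := congrArg (evalT (xc w a b c y)) row10_struct
  simp only [evalT_normalize, evalT_append, evalT_e3Minus, evalT_e3Plus, linEval_σL] at he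
  simp only [linEval, List.map_cons, List.map_nil, List.sum_cons, List.sum_nil, add_zero, xc_0, xc_1, xc_2, xc_3, xc_4, xc_5, xc_6, xc_8, xc_9, xc_10, xc_11, xc_12] at he
  have h0 := GroupThreePointLB.sahiE3_groupPairSep_nonneg w ({a, y} : Finset V) ({b} : Finset V) c
  simp only [Finset.set_biInter_insert, Finset.set_biInter_singleton] at h0
  rw [sahiE3_def, real_grp_ABC, real_grp_A, real_grp_B, real_hyb1_A, real_grp_BC, real_grp_AC, real_grp_AB] at h0
  linarith

/-- Row 11 (`HYB(P1=b;c=c;P3=a;P3'=ay)`) is valid at the cell point. [this work] -/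
theorem row11_valid : evalT (xc w a b c y) (rowM 11) ≤ evalT (xc w a b c y) (rowP 11) := by
  classical
  have he := congrArg (evalT (xc w a b c y)) row11_struct
  simp only [evalT_normalize, evalT_append, evalT_e3Minus, evalT_e3Plus, linEval_σL] at he
  simp only [linEval, List.map_cons, List.map_nil, List.sum_cons, List.sum_nil, add_zero, xc_0, xc_1, xc_2, xc_3, xc_4, xc_5, xc_6, xc_7, xc_8, xc_9, xc_10, xc_11, xc_12] at he
  have h0 := HybridThreePointLB.sahiE3_hybrid_nonneg w c ({b} : Finset V) ({a} : Finset V) ({a, y} : Finset V)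
    (Finset.singleton_subset_iff.2 (Finset.mem_insert_self a {y}))
  rw [setOf_forall_singleton, setOf_forall_singleton, setOf_forall₂_pair_singleton] at h0
  rw [sahiE3_def, real_xDcbDcaIDabDybJ, real_xDcb, real_xDca, real_grp_A, real_xDcaIDabDybJ, real_xDcbIDabDybJ, real_xDcbDca] at h0
  linarith

/-- Row 12 (`HYB(P1=y;c=b;P3=a;P3'=ac)`) is valid at the cell point. [this work] -/
theorem row12_valid : evalT (xc w a b c y) (rowM 12) ≤ evalT (xc w a b c y) (rowP 12) := by
  classical
  have he := congrArg (evalT (xc w a b c y)) row12_struct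
  simp only [evalT_normalize, evalT_append, evalT_e3Minus, evalT_e3Plus, linEval_σL] at he
  simp only [linEval, List.map_cons, List.map_nil, List.sum_cons, List.sum_nil, add_zero, xc_0, xc_1, xc_2, xc_3, xc_4, xc_5, xc_6, xc_7, xc_8, xc_9, xc_10, xc_11, xc_13] at he
  have h0 := HybridThreePointLB.sahiE3_hybrid_nonneg w b ({y} : Finset V) ({a} : Finset V) ({a, c} : Finset V)
    (Finset.singleton_subset_iff.2 (Finset.mem_insert_self a {c}))
  rw [setOf_forall_singleton, setOf_forall_singleton, setOf_forall₂_pair_singleton] at h0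
  rw [sahiE3_def, real_xDbyDbaIDayDcyJ, real_xDby, real_xDba, real_xDayDcy, real_xDbaIDayDcyJ, real_xDbyIDayDcyJ, real_xDbyDba] at h0
  linarith

/-- Row 13 (`HYB(P1=y;c=b;P3=ac;P3'=ac)`) is valid at the cell point. [this work] -/
theorem row13_valid : evalT (xc w a b c y) (rowM 13) ≤ evalT (xc w a b c y) (rowP 13) := by
  classical
  have he := congrArg (evalT (xc w a b c y)) row13_struct
  simp only [evalT_normalize, evalT_append, evalT_e3Minus, evalT_e3Plus, linEval_σL] at he
  simp only [linEval, List.map_cons, List.map_nil, List.sum_cons, List.sum_nil, add_zero, xc_0, xc_1, xc_2, xc_3, xc_4, xc_5, xc_6, xc_8, xc_9, xc_10, xc_11, xc_13] at he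
  have h0 := GroupThreePointLB.sahiE3_groupPairSep_nonneg w ({a, c} : Finset V) ({y} : Finset V) b
  simp only [Finset.set_biInter_insert, Finset.set_biInter_singleton] at h0
  rw [sahiE3_def, real_xDayDcyIDabDcbJDyb, real_xDayDcy, real_xDabDcb, real_xDyb, real_xDabDcbDyb, real_xDayDcyDyb, real_xDayDcyIDabDcbJ] at h0
  linarith

/-- Row 14 (`HYB(P1=y;c=c;P3=a;P3'=ab)`) is valid at the cell point. [this work] -/
theorem row14_valid : evalT (xc w a b c y) (rowM 14) ≤ evalT (xc w a b c y) (rowP 14) := by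
  classical
  have he := congrArg (evalT (xc w a b c y)) row14_struct
  simp only [evalT_normalize, evalT_append, evalT_e3Minus, evalT_e3Plus, linEval_σL] at he
  simp only [linEval, List.map_cons, List.map_nil, List.sum_cons, List.sum_nil, add_zero, xc_0, xc_1, xc_2, xc_3, xc_4, xc_5, xc_6, xc_7, xc_8, xc_9, xc_11, xc_12, xc_13] at he
  have h0 := HybridThreePointLB.sahiE3_hybrid_nonneg w c ({y} : Finset V) ({a} : Finset V) ({a, b} : Finset V)
    (Finset.singleton_subset_iff.2 (Finset.mem_insert_self a {b}))
  rw [setOf_forall_singleton, setOf_forall_singleton, setOf_forall₂_pair_singleton] at h0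
  rw [sahiE3_def, real_xDcyDcaIDayDbyJ, real_xDcy, real_xDca, real_xDayDby, real_xDcaIDayDbyJ, real_xDcyIDayDbyJ, real_xDcyDca] at h0
  linarith

/-- Row 15 (`HYBq(P1=b;c=a;P3=c;P3'=c)`) is valid at the cell point. [this work] -/
theorem row15_valid : evalT (xc w a b c y) (rowM 15) ≤ evalT (xc w a b c y) (rowP 15) := by
  classical
  have he := congrArg (evalT (xc w a b c y)) row15_struct
  simp only [evalT_normalize, evalT_append, evalT_e3Minus, evalT_e3Plus, linEval_σL] at he
  simp only [linEval, List.map_cons, List.map_nil, List.sum_cons, List.sum_nil, add_zero, xc_0, xc_1, xc_2, xc_3, xc_4, xc_5, xc_6, xc_8, xc_10, xc_12] at he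
  have h0 := ThreePointLB.sahiE3_pairSep_nonneg (Function.update w s(a, y) 1) a b c
  rw [sahiE3_def] at h0
  simp only [real_update_ay] at h0
  rw [real_qDabDacDbc, real_qDab, real_qDac, real_qDbc, real_qDacDbc, real_qDabDbc, real_qDabDac] at h0
  linarith

/-- Every row index is valid (indices `≥ 16` carry empty rows). [this work] -/
theorem rowValid : ∀ i : ℕ, evalT (xc w a b c y) (rowM i) ≤ evalT (xc w a b c y) (rowP i)
  | 0 => row0_valid w a b c y
  | 1 => row1_valid w a b c y
  | 2 => row2_valid w a b c y
  | 3 => row3_valid w a b c y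
  | 4 => row4_valid w a b c y
  | 5 => row5_valid w a b c y
  | 6 => row6_valid w a b c y
  | 7 => row7_valid w a b c y
  | 8 => row8_valid w a b c y
  | 9 => row9_valid w a b c y
  | 10 => row10_valid w a b c y
  | 11 => row11_valid w a b c y
  | 12 => row12_valid w a b c y
  | 13 => row13_valid w a b c y
  | 14 => row14_valid w a b c y
  | 15 => row15_valid w a b c y
  | n + 16 => by simp [rowP, rowM]

/-- **All signed rows of the certificate are valid at the cell point, on the region `x₁ ≤ x₂`.** [this work] -/
theorem rowsS_valid (hreg : cell w a b c y 1 ≤ cell w a b c y 2) :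
    ∀ r ∈ rowsS, evalT (xc w a b c y) r.minus ≤ evalT (xc w a b c y) r.plus := by
  have hreg' : xc w a b c y 1 ≤ xc w a b c y 2 := by rw [xc_1, xc_2]; exact hreg
  intro r hr
  rcases List.mem_append.1 hr with h | h
  · obtain ⟨col, _, rfl⟩ := List.mem_map.1 h
    unfold colRow
    split
    · exact reg_row_valid (xc w a b c y) hreg' (rowValid w a b c y col.1)
    · exact rowValid w a b c y col.1
  · obtain ⟨col, _, rfl⟩ := List.mem_map.1 h
    simp only [regRow, evalT_cons, evalT_nil, evalM, List.map_cons, List.map_nil, List.prod_cons, List.prod_nil, Nat.cast_one]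
    linarith

/-- **The target term lists evaluate to `polL₁` of the cells.** [this work] -/
theorem target_eval :
    evalT (xc w a b c y) tP - evalT (xc w a b c y) tM =
      polL₁ (cell w a b c y 0) (cell w a b c y 1) (cell w a b c y 2) (cell w a b c y 3) (cell w a b c y 4) (cell w a b c y 5)
        (cell w a b c y 6) (cell w a b c y 7) (cell w a b c y 8) (cell w a b c y 9) (cell w a b c y 10) (cell w a b c y 11)
        (cell w a b c y 12) (cell w a b c y 13) (cell w a b c y 14) := by
  have he1 := congrArg (evalT (xc w a b c y)) target1_struct
  have he2 := congrArg (evalT (xc w a b c y)) target2_struct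
  have he3 := congrArg (evalT (xc w a b c y)) target_split
  simp only [evalT_normalize, evalT_append, evalT_e3Minus, evalT_e3Plus, evalT_mulT, evalT_linT, linEval_σL] at he1 he2 he3
  simp only [linEval, List.map_cons, List.map_nil, List.sum_cons, List.sum_nil, add_zero, xc_0, xc_1, xc_2, xc_3, xc_4, xc_5, xc_6, xc_7, xc_8, xc_9, xc_10, xc_11, xc_12] at he1 he2
  simp only [polL₁, hybE₁, hybE₂, E3h]
  rw [sum_cell_eq_one w a b c y]
  linarith

omit [Fintype V] in
/-- A single term is dominated by the whole (nonnegative) term list. [folklore] -/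
theorem term_le_evalT {l : List Term} {t : Term} (ht : t ∈ l) :
    (t.2 : ℝ) * evalM (xc w a b c y) t.1 ≤ evalT (xc w a b c y) l := by
  unfold evalT
  exact List.single_le_sum (fun s hs => by
    obtain ⟨u, _, rfl⟩ := List.mem_map.1 hs
    exact mul_nonneg (Nat.cast_nonneg _) (evalM_nonneg _ (xc_nonneg w a b c y) _)) _ (List.mem_map.2 ⟨t, ht, rfl⟩)

omit [Fintype V] in
/-- The multiplier dominates `W·x_2²` (cell 2 is not `b`-isolated). [this work] -/
theorem certM_sq_2 : (11339279676614 : ℝ) * (cell w a b c y 2 * cell w a b c y 2) ≤ evalT (xc w a b c y) certM := by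
  have h := term_le_evalT w a b c y (l := certM) (t := ([2, 2], 11339279676614)) (by decide)
  simpa [evalM, xc_2] using h

omit [Fintype V] in
/-- The multiplier dominates `W·x_3²` (cell 3 is not `b`-isolated). [this work] -/
theorem certM_sq_3 : (11339279676614 : ℝ) * (cell w a b c y 3 * cell w a b c y 3) ≤ evalT (xc w a b c y) certM := by
  have h := term_le_evalT w a b c y (l := certM) (t := ([3, 3], 11339279676614)) (by decide)
  simpa [evalM, xc_3] using h

omit [Fintype V] in
/-- The multiplier dominates `W·x_6²` (cell 6 is not `b`-isolated). [this work] -/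
theorem certM_sq_6 : (11339279676614 : ℝ) * (cell w a b c y 6 * cell w a b c y 6) ≤ evalT (xc w a b c y) certM := by
  have h := term_le_evalT w a b c y (l := certM) (t := ([6, 6], 11339279676614)) (by decide)
  simpa [evalM, xc_6] using h

omit [Fintype V] in
/-- The multiplier dominates `W·x_7²` (cell 7 is not `b`-isolated). [this work] -/
theorem certM_sq_7 : (22678559353228 : ℝ) * (cell w a b c y 7 * cell w a b c y 7) ≤ evalT (xc w a b c y) certM := by
  have h := term_le_evalT w a b c y (l := certM) (t := ([7, 7], 22678559353228)) (by decide)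
  simpa [evalM, xc_7] using h

omit [Fintype V] in
/-- The multiplier dominates `W·x_8²` (cell 8 is not `b`-isolated). [this work] -/
theorem certM_sq_8 : (11339279676614 : ℝ) * (cell w a b c y 8 * cell w a b c y 8) ≤ evalT (xc w a b c y) certM := by
  have h := term_le_evalT w a b c y (l := certM) (t := ([8, 8], 11339279676614)) (by decide)
  simpa [evalM, xc_8] using h

omit [Fintype V] in
/-- The multiplier dominates `W·x_9²` (cell 9 is not `b`-isolated). [this work] -/
theorem certM_sq_9 : (8497387349687 : ℝ) * (cell w a b c y 9 * cell w a b c y 9) ≤ evalT (xc w a b c y) certM := by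
  have h := term_le_evalT w a b c y (l := certM) (t := ([9, 9], 8497387349687)) (by decide)
  simpa [evalM, xc_9] using h

omit [Fintype V] in
/-- The multiplier dominates `W·x_11²` (cell 11 is not `b`-isolated). [this work] -/
theorem certM_sq_11 : (24360317258890 : ℝ) * (cell w a b c y 11 * cell w a b c y 11) ≤ evalT (xc w a b c y) certM := by
  have h := term_le_evalT w a b c y (l := certM) (t := ([11, 11], 24360317258890)) (by decide)
  simpa [evalM, xc_11] using h

omit [Fintype V] in
/-- The multiplier dominates `W·x_12²` (cell 12 is not `b`-isolated). [this work] -/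
theorem certM_sq_12 : (11339279676614 : ℝ) * (cell w a b c y 12 * cell w a b c y 12) ≤ evalT (xc w a b c y) certM := by
  have h := term_le_evalT w a b c y (l := certM) (t := ([12, 12], 11339279676614)) (by decide)
  simpa [evalM, xc_12] using h

omit [Fintype V] in
/-- The multiplier dominates `W·x_13²` (cell 13 is not `b`-isolated). [this work] -/
theorem certM_sq_13 : (45357118706456 : ℝ) * (cell w a b c y 13 * cell w a b c y 13) ≤ evalT (xc w a b c y) certM := by
  have h := term_le_evalT w a b c y (l := certM) (t := ([13, 13], 45357118706456)) (by decide)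
  simpa [evalM, xc_13] using h

omit [Fintype V] in
/-- The multiplier dominates `W·x_14²` (cell 14 is not `b`-isolated). [this work] -/
theorem certM_sq_14 : (45357118706456 : ℝ) * (cell w a b c y 14 * cell w a b c y 14) ≤ evalT (xc w a b c y) certM := by
  have h := term_le_evalT w a b c y (l := certM) (t := ([14, 14], 45357118706456)) (by decide)
  simpa [evalM, xc_14] using h

end Point

end L1Cert

end Summit.CriticalPhenomena.PercolationContinuityZ3.Theorems
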